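import Literature.NumberTheory.ConnesMoscovici2022.UVProlateMinDomainAtInfinity
import Literature.NumberTheory.ConnesMoscovici2022.UVProlateThm16Assembly
import HarnessLib

/-!
# Connes–Moscovici 2022, §1: `dom W_min ⊆ dom W_sa` — the minimal domain satisfies (1.19)–(1.21)

LINE 1 — FRAMING. RH-FREE corpus literature (cell rh-crit, C1 Connes–Consani/Moscovici corpus,
row O2 `UVProlateSpectrum`: the self-adjointness theory of the prolate wave operator
`W_λ = −∂ₓ(λ² − x²)∂ₓ + (2πλx)²`; sequel material with no leaf / binder role in any route).
bears_on: LADDER-RH W-C/W-P.  WHAT THIS IS NOT: any claim about `ζ` or RH; nothing here bears on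
the truth of RH.  Theorems only: 0 `def`s, 0 named facts, no `sorry`.

## Source and purpose

A. Connes, H. Moscovici, *The UV prolate spectrum matches the zeros of zeta*, PNAS 119 (2022)
[ConnesMoscovici2022] = arXiv:2112.05500, §1 (= arXiv §2): Lemma 1.2 (iv), the definition of
`dom W_sa` by (1.19)–(1.21) and Thm 1.6 (i) (held text `paper-arxiv-2112.05500`, chunk
p0004:L88–L99, p0006:L52–L90).

**`prolateMin_domain_le_prolateSADomain (hlam) : (prolateMin λ).domain ≤ prolateSADomain λ hlam`**
— every element of the minimal domain (closure of `W_λ` on `𝒮(ℝ)`) satisfies the printed boundary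
conditions: (1.19) by `UVProlateMinDomainBC.tendsto_pDeriv_nhdsWithin_zero_of_mem_prolateMin`;
at `±∞`, the even and odd parts `½(ξ ± Rξ)` (`R` = reflection, `dom W_max`-stable by seat cc-t10's
`compNeg_mem_prolateMax`, and `⟪Ru, v⟫ = ⟪u, Rv⟫`) are again `W_max`-symmetric against `dom W_max`,
their regular representatives are `evenFn g`, `oddFn g` (seat cc-t6's `ftc_evenFn/ftc_oddFn`),
so `UVProlateMinDomainAtInfinity.coeffs_eq_zero_of_inner_symm` kills both `+∞` coefficients and
`tendsto_bcInfEven/Odd_of_asymptotics` (+ parity for `−∞`) give (1.20)/(1.21).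

This is the hypothesis `hmin` of seat cc-t11's von Neumann road to [ConnesMoscovici2022, Thm 1.6 (i)]
— discharged here: `prolateMin_le_prolateSA'` (`W_min ≤ W_sa`) and
`isSelfAdjoint_prolateSA_of_independent_four` (= `UVProlateThm16Assembly.
isSelfAdjoint_prolateSA_of_minDomain_le_of_independent` with `hmin` supplied: `W_sa` is
self-adjoint as soon as four elements of `𝓛_β` are independent modulo `dom W_min`).
Cell rh-crit seat cc-t14 g3.
-/

noncomputable section

open Complex Set MeasureTheory Filter Topology intervalIntegral Metric
open scoped Real Topology ContDiff InnerProductSpace ComplexConjugate SchwartzMap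

namespace Literature.NumberTheory.ConnesMoscovici2022

open Literature.NumberTheory.ConnesConsani2021 Literature.NumberTheory.ConnesConsani2024

variable {lam : ℝ}

/-! ## §0. The reflection `R ξ = ξ(−·)` on `L²(ℝ)` is symmetric -/

/-- `⟪R u, v⟫ = ⟪u, R v⟫` for the reflection `R` on `L²(ℝ)`. [folklore] -/
private theorem inner_compNeg_comm (u v : L2R) :
    ⟪Lp.compMeasurePreserving (fun x : ℝ ↦ -x) (Measure.measurePreserving_neg volume) u, v⟫_ℂ =
      ⟪u, Lp.compMeasurePreserving (fun x : ℝ ↦ -x) (Measure.measurePreserving_neg volume) v⟫_ℂ := by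
  rw [MeasureTheory.L2.inner_def, MeasureTheory.L2.inner_def]
  have h1 := Lp.coeFn_compMeasurePreserving u (Measure.measurePreserving_neg (volume : Measure ℝ))
  have h2 := Lp.coeFn_compMeasurePreserving v (Measure.measurePreserving_neg (volume : Measure ℝ))
  have e1 : ∫ a : ℝ, ⟪(Lp.compMeasurePreserving (fun x : ℝ ↦ -x) (Measure.measurePreserving_neg volume)
      u : L2R) a, (v : ℝ → ℂ) a⟫_ℂ = ∫ a : ℝ, ⟪(u : ℝ → ℂ) (-a), (v : ℝ → ℂ) a⟫_ℂ :=
    integral_congr_ae (by filter_upwards [h1] with a ha; rw [ha]; rfl)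
  have e2 : ∫ a : ℝ, ⟪(u : ℝ → ℂ) a, (Lp.compMeasurePreserving (fun x : ℝ ↦ -x)
      (Measure.measurePreserving_neg volume) v : L2R) a⟫_ℂ =
      ∫ a : ℝ, ⟪(u : ℝ → ℂ) a, (v : ℝ → ℂ) (-a)⟫_ℂ :=
    integral_congr_ae (by filter_upwards [h2] with a ha; rw [ha]; rfl)
  rw [e1, e2, ← integral_neg_eq_self (fun a : ℝ ↦ ⟪(u : ℝ → ℂ) a, (v : ℝ → ℂ) (-a)⟫_ℂ) volume]
  simp only [neg_neg]

/-! ## §1. `dom W_min ⊆ 𝓛_β` -/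

section MinDomain

variable (hlam : 0 < lam)
include hlam

/-- Reflection identity for the even boundary expression: for an even `C¹`-off-`{±λ}` function
`h = evenFn g`, `bcInfEven λ h (−x) = −bcInfEven λ h (x)` off `{±λ}`. [folklore] -/
private theorem bcInfEven_evenFn_neg {g : ℝ → ℂ} (hg : ContDiffOn ℝ 1 g {x | x ≠ lam ∧ x ≠ -lam})
    {x : ℝ} (hx : x ∈ {x : ℝ | x ≠ lam ∧ x ≠ -lam}) :
    bcInfEven lam (evenFn g) (-x) = -bcInfEven lam (evenFn g) x := by
  have _ := hlam
  have hx' : -x ∈ {x : ℝ | x ≠ lam ∧ x ≠ -lam} :=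
    ⟨fun h ↦ hx.2 (by linarith), fun h ↦ hx.1 (by linarith)⟩
  have hd := deriv_evenFn_of_mem hg hx
  have hd' := deriv_evenFn_of_mem hg hx'
  rw [neg_neg] at hd'
  have hev : evenFn g (-x) = evenFn g x := by simp only [evenFn, neg_neg]; ring
  simp only [bcInfEven, hd, hd', hev, mul_neg, Real.sin_neg, Real.cos_neg]
  push_cast
  ring

/-- Reflection identity for the odd boundary expression: for `h = oddFn g`,
`bcInfOdd λ h (−x) = −bcInfOdd λ h (x)` off `{±λ}`. [folklore] -/
private theorem bcInfOdd_oddFn_neg {g : ℝ → ℂ} (hg : ContDiffOn ℝ 1 g {x | x ≠ lam ∧ x ≠ -lam})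
    {x : ℝ} (hx : x ∈ {x : ℝ | x ≠ lam ∧ x ≠ -lam}) :
    bcInfOdd lam (oddFn g) (-x) = -bcInfOdd lam (oddFn g) x := by
  have _ := hlam
  have hx' : -x ∈ {x : ℝ | x ≠ lam ∧ x ≠ -lam} :=
    ⟨fun h ↦ hx.2 (by linarith), fun h ↦ hx.1 (by linarith)⟩
  have hd := deriv_oddFn_of_mem hg hx
  have hd' := deriv_oddFn_of_mem hg hx'
  rw [neg_neg] at hd'
  have hov : oddFn g (-x) = -oddFn g x := by simp only [oddFn, neg_neg]; ring
  simp only [bcInfOdd, hd, hd', hov, mul_neg, Real.sin_neg, Real.cos_neg]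
  push_cast
  ring

/-- **`dom W_min ⊆ 𝓛_β`**: every element of the minimal domain (the closure of `W_λ` on `𝒮(ℝ)`)
satisfies the boundary conditions (1.19)–(1.21) — (1.19) by `UVProlateMinDomainBC`, and at
`±∞` both asymptotic coefficients of the even and odd parts vanish
(`coeffs_eq_zero_of_inner_symm` applied to `½(ξ ± Rξ)`, `R` the reflection, which are again
`W_max`-symmetric), so (1.20)/(1.21) hold by `tendsto_bcInfEven/Odd_of_asymptotics` and parity.
This is the hypothesis `hmin` of the von Neumann road to [Thm 1.6 (i)]
(`UVProlateThm16Assembly.isSelfAdjoint_prolateSA_of_minDomain_le_of_independent`): the minimal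
domain is contained in `dom W_sa` ("`W_min ⊂ W_sa ⊂ W_max`").
[cite: ConnesMoscovici2022, §1 Lemma 1.2 (iv), definition of `dom W_sa` (1.19)–(1.21) and Thm 1.6 (i) (= arXiv:2112.05500 Lemma 2.2, (2.19)–(2.21), Thm 2.6, chunk p0004:L88–L99, p0006:L52–L90)] -/
theorem prolateMin_domain_le_prolateSADomain :
    (prolateMin lam).domain ≤ prolateSADomain lam hlam := by
  intro ξ hξmin
  have hξmax : ξ ∈ (prolateMax lam).domain := (prolateMin_le_prolateMax lam).1 hξmin
  set ξd : (prolateMax lam).domain := ⟨ξ, hξmax⟩ with hξd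
  obtain ⟨g, hae, hg, hftc, -, -⟩ := exists_regular_repr hlam ξd
  set S : Set ℝ := {x | x ≠ lam ∧ x ≠ -lam} with hS
  have hIoiS : Ioi lam ⊆ S := fun x hx ↦ ⟨ne_of_gt hx, by intro h; rw [h] at hx; exact absurd hx (by simp [hlam.le])⟩
  -- symmetry of `ξ` against `dom W_max`
  have hsym : ∀ ζ : (prolateMax lam).domain,
      ⟪(prolateMax lam ξd : L2R), (ζ : L2R)⟫_ℂ = ⟪(ξd : L2R), (prolateMax lam ζ : L2R)⟫_ℂ :=
    fun ζ ↦ inner_prolateMax_comm_of_mem_prolateMin_left ξd ζ hξmin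
  -- (1.19)
  obtain ⟨hL, hNL⟩ := tendsto_pDeriv_nhdsWithin_zero_of_mem_prolateMin hlam ξd hξmin hae hg hftc
  -- the reflection `R ξ`
  have hneg := Measure.measurePreserving_neg (volume : Measure ℝ)
  obtain ⟨hRmem, hRW⟩ := compNeg_mem_prolateMax lam ξd
  set ξR : (prolateMax lam).domain :=
    ⟨Lp.compMeasurePreserving (fun x : ℝ ↦ -x) (Measure.measurePreserving_neg volume) (ξd : L2R),
      hRmem⟩ with hξR
  have hsymR : ∀ ζ : (prolateMax lam).domain,
      ⟪(prolateMax lam ξR : L2R), (ζ : L2R)⟫_ℂ = ⟪(ξR : L2R), (prolateMax lam ζ : L2R)⟫_ℂ := by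
    intro ζ
    obtain ⟨hζR, hζRW⟩ := compNeg_mem_prolateMax lam ζ
    rw [hξR, hRW, inner_compNeg_comm, hsym ⟨_, hζR⟩, hζRW, ← inner_compNeg_comm]
  -- representatives: `R ξ = g(−·)`, `W_max (R ξ) = η(−·)` a.e.
  set η : ℝ → ℂ := fun t ↦ ((prolateMax lam ξd : L2R) : ℝ → ℂ) t with hη
  have haeR : ((ξR : L2R) : ℝ → ℂ) =ᵐ[volume] fun x ↦ g (-x) :=
    (Lp.coeFn_compMeasurePreserving _ hneg).trans (hneg.quasiMeasurePreserving.ae_eq_comp hae)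
  have hWR : ((prolateMax lam ξR : L2R) : ℝ → ℂ) =ᵐ[volume] fun x ↦ η (-x) := by
    rw [hξR, hRW]
    exact (Lp.coeFn_compMeasurePreserving _ hneg).trans (Eventually.of_forall fun x ↦ rfl)
  have hηi : ∀ a b, IntervalIntegrable η volume a b := fun a b ↦
    (((Lp.memLp (prolateMax lam ξd : L2R)).locallyIntegrable (by norm_num)).integrableOn_isCompact
      isCompact_uIcc).intervalIntegrable
  -- even and odd parts `½(ξ ± Rξ)`
  set ξe : (prolateMax lam).domain := (1 / 2 : ℂ) • (ξd + ξR) with hξe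
  set ξo : (prolateMax lam).domain := (1 / 2 : ℂ) • (ξd - ξR) with hξo
  have hsyme : ∀ ζ : (prolateMax lam).domain,
      ⟪(prolateMax lam ξe : L2R), (ζ : L2R)⟫_ℂ = ⟪(ξe : L2R), (prolateMax lam ζ : L2R)⟫_ℂ := by
    intro ζ
    rw [hξe, LinearPMap.map_smul, LinearPMap.map_add, Submodule.coe_smul, Submodule.coe_add,
      inner_smul_left, inner_smul_left, inner_add_left, inner_add_left, hsym, hsymR]
  have hsymo : ∀ ζ : (prolateMax lam).domain,
      ⟪(prolateMax lam ξo : L2R), (ζ : L2R)⟫_ℂ = ⟪(ξo : L2R), (prolateMax lam ζ : L2R)⟫_ℂ := by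
    intro ζ
    rw [hξo, LinearPMap.map_smul, LinearPMap.map_sub, Submodule.coe_smul, Submodule.coe_sub,
      inner_smul_left, inner_smul_left, inner_sub_left, inner_sub_left, hsym, hsymR]
  have haee : ((ξe : L2R) : ℝ → ℂ) =ᵐ[volume] evenFn g := by
    rw [hξe, Submodule.coe_smul, Submodule.coe_add]
    filter_upwards [Lp.coeFn_smul (1 / 2 : ℂ) ((ξd : L2R) + (ξR : L2R)),
      Lp.coeFn_add (ξd : L2R) (ξR : L2R), hae, haeR] with x h1 h2 h3 h4
    rw [h1, Pi.smul_apply, h2, Pi.add_apply, h3, h4, evenFn, smul_eq_mul]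
    ring
  have haeo : ((ξo : L2R) : ℝ → ℂ) =ᵐ[volume] oddFn g := by
    rw [hξo, Submodule.coe_smul, Submodule.coe_sub]
    filter_upwards [Lp.coeFn_smul (1 / 2 : ℂ) ((ξd : L2R) - (ξR : L2R)),
      Lp.coeFn_sub (ξd : L2R) (ξR : L2R), hae, haeR] with x h1 h2 h3 h4
    rw [h1, Pi.smul_apply, h2, Pi.sub_apply, h3, h4, oddFn, smul_eq_mul]
    ring
  have hWe : ((prolateMax lam ξe : L2R) : ℝ → ℂ) =ᵐ[volume] evenFn η := by
    rw [hξe, LinearPMap.map_smul, LinearPMap.map_add]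
    filter_upwards [Lp.coeFn_smul (1 / 2 : ℂ) ((prolateMax lam ξd : L2R) + (prolateMax lam ξR : L2R)),
      Lp.coeFn_add (prolateMax lam ξd : L2R) (prolateMax lam ξR : L2R), hWR] with x h1 h2 h4
    rw [h1, Pi.smul_apply, h2, Pi.add_apply, h4, evenFn, smul_eq_mul]
    ring
  have hWo : ((prolateMax lam ξo : L2R) : ℝ → ℂ) =ᵐ[volume] oddFn η := by
    rw [hξo, LinearPMap.map_smul, LinearPMap.map_sub]
    filter_upwards [Lp.coeFn_smul (1 / 2 : ℂ) ((prolateMax lam ξd : L2R) - (prolateMax lam ξR : L2R)),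
      Lp.coeFn_sub (prolateMax lam ξd : L2R) (prolateMax lam ξR : L2R), hWR] with x h1 h2 h4
    rw [h1, Pi.smul_apply, h2, Pi.sub_apply, h4, oddFn, smul_eq_mul]
    ring
  -- FTC forms for the even/odd parts (seat cc-t6), with the `L²` images of `ξe`, `ξo`
  have hftce : ∀ x y, x ≤ y → Icc x y ⊆ S →
      pCoeff lam y * deriv (evenFn g) y - pCoeff lam x * deriv (evenFn g) x =
        ∫ t in x..y, (qCoeff lam t * evenFn g t - (prolateMax lam ξe : L2R) t) := by
    intro x y hxy hI
    rw [ftc_evenFn hg hftc hηi x y hxy hI]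
    refine intervalIntegral.integral_congr_ae ?_
    filter_upwards [hWe] with t ht _
    rw [ht]
  have hftco : ∀ x y, x ≤ y → Icc x y ⊆ S →
      pCoeff lam y * deriv (oddFn g) y - pCoeff lam x * deriv (oddFn g) x =
        ∫ t in x..y, (qCoeff lam t * oddFn g t - (prolateMax lam ξo : L2R) t) := by
    intro x y hxy hI
    rw [ftc_oddFn hg hftc hηi x y hxy hI]
    refine intervalIntegral.integral_congr_ae ?_
    filter_upwards [hWo] with t ht _
    rw [ht]
  -- `+∞` asymptotics of the even/odd parts, and vanishing of their coefficients
  have hge : ContDiffOn ℝ 1 (evenFn g) S := contDiffOn_evenFn hg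
  have hgo : ContDiffOn ℝ 1 (oddFn g) S := contDiffOn_oddFn hg
  have hL2e : IntegrableOn (fun t ↦ ‖((prolateMax lam ξe : L2R) : ℝ → ℂ) t‖ ^ 2) (Ioi lam) :=
    ((memLp_two_iff_integrable_sq_norm (Lp.aestronglyMeasurable _)).1 (Lp.memLp _)).integrableOn
  have hL2o : IntegrableOn (fun t ↦ ‖((prolateMax lam ξo : L2R) : ℝ → ℂ) t‖ ^ 2) (Ioi lam) :=
    ((memLp_two_iff_integrable_sq_norm (Lp.aestronglyMeasurable _)).1 (Lp.memLp _)).integrableOn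
  obtain ⟨Ae, Be, h1e, h2e⟩ := exists_asymptotics_atTop_of_ftc hlam (x₀ := lam) (hge.mono hIoiS)
    (fun x y hx hxy ↦ hftce x y hxy fun t ht ↦ hIoiS (lt_of_lt_of_le hx ht.1))
    (Lp.aestronglyMeasurable _).restrict hL2e
  obtain ⟨Ao, Bo, h1o, h2o⟩ := exists_asymptotics_atTop_of_ftc hlam (x₀ := lam) (hgo.mono hIoiS)
    (fun x y hx hxy ↦ hftco x y hxy fun t ht ↦ hIoiS (lt_of_lt_of_le hx ht.1))
    (Lp.aestronglyMeasurable _).restrict hL2o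
  obtain ⟨hAe, hBe⟩ := coeffs_eq_zero_of_inner_symm hlam ξe haee hge hftce hsyme h1e h2e
  obtain ⟨hAo, hBo⟩ := coeffs_eq_zero_of_inner_symm hlam ξo haeo hgo hftco hsymo h1o h2o
  subst hAe hBe hAo hBo
  have hEtop : Tendsto (bcInfEven lam (evenFn g)) atTop (𝓝 0) := by
    have h := tendsto_bcInfEven_of_asymptotics lam h1e h2e
    rwa [mul_zero, neg_zero] at h
  have hOtop : Tendsto (bcInfOdd lam (oddFn g)) atTop (𝓝 0) := by
    have h := tendsto_bcInfOdd_of_asymptotics lam h1o h2o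
    rwa [mul_zero] at h
  -- `−∞` by parity
  have hEbot : Tendsto (bcInfEven lam (evenFn g)) atBot (𝓝 0) := by
    have h := (hEtop.comp tendsto_neg_atBot_atTop).neg
    rw [neg_zero] at h
    refine h.congr' ?_
    filter_upwards [eventually_lt_atBot (-lam)] with x hx
    have hxS : x ∈ S := ⟨by intro h'; rw [h'] at hx; linarith, ne_of_lt hx⟩
    have := bcInfEven_evenFn_neg hlam hg hxS
    simp only [Function.comp] at this ⊢
    rw [this, neg_neg]
  have hObot : Tendsto (bcInfOdd lam (oddFn g)) atBot (𝓝 0) := by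
    have h := (hOtop.comp tendsto_neg_atBot_atTop).neg
    rw [neg_zero] at h
    refine h.congr' ?_
    filter_upwards [eventually_lt_atBot (-lam)] with x hx
    have hxS : x ∈ S := ⟨by intro h'; rw [h'] at hx; linarith, ne_of_lt hx⟩
    have := bcInfOdd_oddFn_neg hlam hg hxS
    simp only [Function.comp] at this ⊢
    rw [this, neg_neg]
  exact ⟨hξmax, g, hae, ⟨hg.differentiableOn one_ne_zero, hL, hNL, hEtop, hEbot, hOtop, hObot⟩⟩

/-- **`W_min ⊂ W_sa`** in the extension order: the self-adjoint realisation `W_sa` (the tree's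
`prolateSA`) extends the minimal operator. [cite: ConnesMoscovici2022, §1 Thm 1.6 (i) and the definition of `W_sa` (= arXiv:2112.05500 Thm 2.6, chunk p0006:L52–L76)] -/
theorem prolateMin_le_prolateSA' : prolateMin lam ≤ prolateSA lam hlam :=
  prolateMin_le_prolateSA hlam (prolateMin_domain_le_prolateSADomain hlam)

/-- **Thm 1.6 (i), self-adjointness, reduced to four vectors** (seat cc-t11's von Neumann door
with `hmin` discharged): `W_sa` is self-adjoint as soon as four elements of `𝓛_β` are linearly
independent modulo `dom W_min` (the printed `β±, β̂±`).
[cite: ConnesMoscovici2022, Thm 1.6 (i) and Lemma 1.5 (= arXiv:2112.05500 Thm 2.6 (i), Lemma 2.5, chunk p0005:L94–L110, p0006:L70–L81)] -/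
theorem isSelfAdjoint_prolateSA_of_independent_four (u : Fin 4 → L2R)
    (hu : ∀ i, u i ∈ prolateSASet lam)
    (hind : ∀ c : Fin 4 → ℂ, (∑ i, c i • u i) ∈ (prolateMin lam).domain → c = 0) :
    IsSelfAdjoint (prolateSA lam hlam) :=
  isSelfAdjoint_prolateSA_of_minDomain_le_of_independent hlam
    (prolateMin_domain_le_prolateSADomain hlam) u hu hind

end MinDomain

end Literature.NumberTheory.ConnesMoscovici2022

end
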